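import Literature.Geometry.Riemannian.GeneralizedCylinderGeodesics
import Literature.Geometry.Lorentzian.TracedGaussEquationGeneral
import Literature.Geometry.Lorentzian.MetricNormSq
import Literature.Geometry.Lorentzian.IsometryProofs
import HarnessLib

/-!
# The scalar curvature of a generalized cylinder (Bär–Gauduchon–Moroianu 2005, Prop. 4.1;
# Bär–Hanke 2023, §3, (9))

Topic `Literature/Geometry/Riemannian`. A brick of the proof programme of
`Literature.Geometry.Riemannian.BaerHankePscGluing`. For a generalized cylinder
`(N × ℝ, G = g_t + dt²)` (cylinder property `hcyl`, `GeneralizedCylinderGeodesics.lean`) with `G`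
Riemannian, write `g_t = ι_t^* G` for the induced metrics of the slices, `K_t` for the second
fundamental form of `ι_t` w.r.t. `∂_t` (so `ġ_t = 2K_t`, Bär–Hanke's `II_t = -K_t`),
`H_t = tr_{g_t} K_t`, `|K_t|²` for its `g_t`-square norm. This file proves, in every dimension:

* frame lemmas for a hypersurface with unit normal (`val_normal_normalDerivAlong_eq_zero`,
  `val_normalDerivAlong_self_eq_sum`, `ricci_normal_eq_sum`): `g(ν, D_vν) = 0`,
  `|D_vν|² = ∑ₗ K(v, βₗ)²/aₗ` and `Ric(ν, ν) = ∑ᵢ g(R(df βᵢ, ν)ν, df βᵢ)/aᵢ` in an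
  `(f^*g)`-orthogonal basis `β`;
* `hasDerivAt_cyl_sum_secondFundamentalForm_div` — **the traced Riccati identity**:
  `(d/dτ)|_{τ=t} ∑ᵢ K_τ(βᵢ, βᵢ)/aᵢ = -Ric_G(∂_t, ∂_t) + |K_t|²` for a `g_t`-orthogonal basis `β`
  of `T_zN` with `aᵢ = g_t(βᵢ, βᵢ)` (BGM 2005, (4.?); O'Neill 1983, Ch. 8).

The mean-curvature form `∂_t H_t = -Ric(∂_t,∂_t) - |K_t|²` and formula (9) itself are assembled
from this and the traced Gauss equation (`TracedGaussEquationGeneral.lean`) in the sequel.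

Everything is proved; no definitions, no named facts (D-0026).

## References

* C. Bär, P. Gauduchon, A. Moroianu, *Generalized cylinders in semi-Riemannian and spin
  geometry*, Math. Z. 249 (2005) 545–580, Prop. 4.1. [folklore]
* C. Bär, B. Hanke, *Boundary conditions for scalar curvature*, arXiv:2012.09127, §3, (9).
  [BarHanke2023]
* B. O'Neill, *Semi-Riemannian geometry* (1983), Ch. 3, Lemma 3.52; Ch. 4, Lemma 4.19;
  Ch. 8. [ONeill1983]
-/

noncomputable section

open Bundle Set Filter Function Metric
open scoped Manifold ContDiff Topology

namespace Literature.Geometry.Riemannian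

open Literature.Geometry.Lorentzian
open Literature.Geometry.Lorentzian.PseudoRiemannianMetric

/-! ### Frame lemmas for a hypersurface with a unit normal (every dimension) -/

section Frame

variable {E : Type*} [NormedAddCommGroup E] [NormedSpace ℝ E] {H : Type*} [TopologicalSpace H]
  {I : ModelWithCorners ℝ E H} {M : Type*} [TopologicalSpace M] [ChartedSpace H M]
  [IsManifold I ∞ M] [FiniteDimensional ℝ E] [CompleteSpace E]
  (g : PseudoRiemannianMetric I ∞ E (TangentSpace I : M → Type _)) [g.HasLeviCivita]
  {E' : Type*} [NormedAddCommGroup E'] [NormedSpace ℝ E'] {H' : Type*} [TopologicalSpace H']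
  {I' : ModelWithCorners ℝ E' H'} {N : Type*} [TopologicalSpace N] [ChartedSpace H' N]
  [IsManifold I' ∞ N] [FiniteDimensional ℝ E'] [CompleteSpace E'] [I'.Boundaryless] {f : N → M}
  (hpb : contMDiff_pullbackBilin I M I' N ∞) (hfi : g.IsSpacelikeImmersion I' f)
  {ν : NormalField I f} {ε : ℝ}

omit [FiniteDimensional ℝ E'] [CompleteSpace E'] in
/-- **`g(ν, D_v ν) = 0`** for a unit normal field `ν` of constant sign `ε` along `f`
(differentiate `g(ν, ν) = ε` along the chart-straight curve with velocity `v`; O'Neill 1983,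
Ch. 4, Lemma 4.19 ff.). [cite: ONeill1983, Ch. 4, Lemma 4.19] -/
theorem val_normal_normalDerivAlong_eq_zero
    (hν : ContMDiff I' I.tangent ∞ (fun x ↦ (TotalSpace.mk' E (f x) (ν x) : TangentBundle I M)))
    (hun : g.IsUnitNormal I' f ν ε) (y : N) (v : TangentSpace I' y) :
    g.val (f y) (ν y) (g.normalDerivAlong f ν y v) = 0 := by
  set c : ℝ → N := curveThrough I' y v with hc_def
  have hLC := isLeviCivita_leviCivita_holds (g := g)
  have hc0 : c 0 = y := curveThrough_zero I' y v
  have hc : MDifferentiableAt 𝓘(ℝ, ℝ) I' c 0 :=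
    (contMDiffAt_curveThrough_zero (n := 1) y v).mdifferentiableAt one_ne_zero
  have hνlift : MDifferentiableAt 𝓘(ℝ, ℝ) I.tangent
      (fun s ↦ (TotalSpace.mk' E (f (c s)) (ν (c s)) : TangentBundle I M)) 0 :=
    ((hν (c 0)).mdifferentiableAt (by simp)).comp 0 hc
  have hd := g.hasDerivAt_val_apply_along hLC.2 (γ := fun s ↦ f (c s))
    (V := fun s ↦ ν (c s)) (W := fun s ↦ ν (c s)) (t₀ := 0) hνlift hνlift
  have hconst : (fun s ↦ g.val (f (c s)) (ν (c s)) (ν (c s))) = fun _ ↦ ε := by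
    funext s; exact hun.2 (c s)
  rw [hconst] at hd
  have h0 := hd.unique (hasDerivAt_const 0 ε)
  rw [g.symm (f (c 0))
    (covariantDerivAlong g.leviCivita (fun s ↦ f (c s)) (fun s ↦ ν (c s)) 0)] at h0
  have key : ∀ z : N, y = z →
      g.val (f y) (ν y) (g.normalDerivAlong f ν y v) =
      g.val (f z) (ν z) (show TangentSpace I (f z) from
        covariantDerivAlong g.leviCivita (fun s ↦ f (c s)) (fun s ↦ ν (c s)) 0) := by
    rintro z rfl; rfl
  rw [key _ hc0.symm]
  change g.val (f (c 0)) (ν (c 0))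
    (covariantDerivAlong g.leviCivita (fun s ↦ f (c s)) (fun s ↦ ν (c s)) 0) = 0
  linarith

omit [CompleteSpace E'] in
/-- **`|D_v ν|²` in an orthogonal frame** (every dimension): for a unit normal `ν` of sign
`ε ≠ 0` with smooth lift, an `(f^*g)`-orthogonal basis `β` of `T_yN` with `aₗ = (f^*g)(βₗ, βₗ) ≠ 0`
and `v ∈ T_yN`: `g(D_vν, D_vν) = ∑ₗ K(v, βₗ)²/aₗ` — `D_vν` is tangential
(`val_normal_normalDerivAlong_eq_zero`) with `g(D_vν, df u) = K(v, u)`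
(`secondFundamentalForm_apply_holds`), so `D_vν = df(∑ₗ K(v, βₗ)/aₗ · βₗ)`
(`val_eq_inducedMetric_add_normal`). O'Neill 1983, Ch. 4, Lemma 4.19 ff.
[cite: ONeill1983, Ch. 4, Lemma 4.19] -/
theorem val_normalDerivAlong_self_eq_sum {ι : Type*} [Fintype ι] [DecidableEq ι]
    (hν : ContMDiff I' I.tangent ∞ (fun x ↦ (TotalSpace.mk' E (f x) (ν x) : TangentBundle I M)))
    (hun : g.IsUnitNormal I' f ν ε) (hε : ε ≠ 0)
    (hdim : Module.finrank ℝ E = Module.finrank ℝ E' + 1) (y : N)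
    (β : Module.Basis ι ℝ (TangentSpace I' y))
    (hβ : ((g.inducedMetric f hpb hfi).toBilinForm y).IsOrthoᵢ β)
    (hd : ∀ k, (g.inducedMetric f hpb hfi).val y (β k) (β k) ≠ 0) (v : TangentSpace I' y) :
    g.val (f y) (g.normalDerivAlong f ν y v) (g.normalDerivAlong f ν y v) =
      ∑ l, g.secondFundamentalForm I' f ν y v (β l) ^ 2 /
        (g.inducedMetric f hpb hfi).val y (β l) (β l) := by
  set gN := g.inducedMetric f hpb hfi with hgN
  set D : TangentSpace I (f y) := g.normalDerivAlong f ν y v with hD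
  set K : LinearMap.BilinForm ℝ (TangentSpace I' y) := g.secondFundamentalForm I' f ν y with hK
  have hKapply : ∀ u, K v u = g.val (f y) D (mfderiv I' I f y u) := fun u ↦
    secondFundamentalForm_apply_holds (g := g) (I' := I') BoundarylessManifold.isInteriorPoint
      ((hν y).mdifferentiableAt (by simp)) v u
  -- the tangential part `a = ∑ₗ K(v, βₗ)/aₗ · βₗ`
  set a : TangentSpace I' y := ∑ l, (K v (β l) / gN.val y (β l) (β l)) • β l with ha
  have haβ : ∀ k, gN.val y a (β k) = K v (β k) := by
    intro k
    simp only [ha, map_sum, map_smul, _root_.sum_apply, _root_.smul_apply, smul_eq_mul]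
    rw [Finset.sum_eq_single k]
    · field_simp [hd k]
    · intro l _ hlk
      rw [show gN.val y (β l) (β k) = 0 from hβ hlk, mul_zero]
    · intro h; exact absurd (Finset.mem_univ k) h
  have hA : ∀ u : TangentSpace I' y, g.val (f y) D (mfderiv I' I f y u) = gN.val y a u := by
    have hlin : ((g.val (f y) D).comp (mfderiv I' I f y)).toLinearMap =
        (gN.val y a).toLinearMap := by
      refine β.ext fun k ↦ ?_
      simp only [ContinuousLinearMap.coe_coe, ContinuousLinearMap.coe_comp, Function.comp_apply,
        haβ k, hKapply]
    intro u
    exact congrArg (fun L : TangentSpace I' y →ₗ[ℝ] ℝ ↦ L u) hlin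
  have key := val_eq_inducedMetric_add_normal g hpb hfi (y := y) (νy := ν y) (A := D) (B := D)
    (a := a) (b := a) (ε := ε) (fun u ↦ hun.1 y u) (hun.2 y) hε hdim hA hA
  rw [key, g.symm (f y) D (ν y)]
  change gN.val y a a + g.val (f y) (ν y) (g.normalDerivAlong f ν y v) *
    g.val (f y) (ν y) (g.normalDerivAlong f ν y v) / ε = _
  rw [val_normal_normalDerivAlong_eq_zero g hν hun y v, mul_zero, zero_div, add_zero]
  -- `gN(a, a) = ∑ₗ K(v, βₗ)²/aₗ`
  have hexp : gN.val y a a = ∑ l, (K v (β l) / gN.val y (β l) (β l)) * gN.val y a (β l) := by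
    change gN.val y a (∑ l, (K v (β l) / gN.val y (β l) (β l)) • β l) = _
    rw [map_sum]
    simp only [map_smul, smul_eq_mul]
  rw [hexp]
  refine Finset.sum_congr rfl fun l _ ↦ ?_
  rw [haβ l, div_mul_eq_mul_div, sq]

omit [CompleteSpace E] [CompleteSpace E'] [I'.Boundaryless] in
/-- **`Ric(ν, ν)` in an adapted orthogonal frame** (every dimension): for a unit normal `ν` of
sign `ε ≠ 0` and an `(f^*g)`-orthogonal basis `β` of `T_yN` (`aᵢ ≠ 0`),
`Ric(ν, ν) = ∑ᵢ g(R(df βᵢ, ν)ν, df βᵢ)/aᵢ` — O'Neill 1983, Ch. 3, Lemma 3.52 in the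
`g`-orthogonal basis `(df β₀, …, df βₘ₋₁, ν)` of `T_{f y}M`, the term through `ν` vanishing
(`R(ν, ν) = 0`). [cite: ONeill1983, Ch. 3, Lemma 3.52] -/
theorem ricci_normal_eq_sum {m : ℕ} (hun : g.IsUnitNormal I' f ν ε) (hε : ε ≠ 0)
    (hm1 : Module.finrank ℝ E = m + 1) (y : N)
    (β : Module.Basis (Fin m) ℝ (TangentSpace I' y))
    (hβ : ((g.inducedMetric f hpb hfi).toBilinForm y).IsOrthoᵢ β)
    (hd : ∀ k, (g.inducedMetric f hpb hfi).val y (β k) (β k) ≠ 0) :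
    g.ricci (f y) (ν y) (ν y) =
      ∑ i, g.val (f y) (g.riemann (f y) (mfderiv I' I f y (β i)) (ν y) (ν y))
        (mfderiv I' I f y (β i)) / (g.inducedMetric f hpb hfi).val y (β i) (β i) := by
  classical
  set gN := g.inducedMetric f hpb hfi with hgN
  have hn0 : ∀ k, g.val (f y) (mfderiv I' I f y (β k)) (ν y) = 0 := fun k ↦ by
    rw [g.symm]; exact hun.1 y (β k)
  have hνε : g.val (f y) (ν y) (ν y) = ε := hun.2 y
  set v : Fin (m + 1) → TangentSpace I (f y) :=
    Fin.snoc (α := fun _ ↦ TangentSpace I (f y)) (fun i ↦ mfderiv I' I f y (β i)) (ν y)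
    with hv
  have hvc : ∀ i : Fin m, v i.castSucc = mfderiv I' I f y (β i) := fun i ↦ by simp [hv]
  have hvl : v (Fin.last m) = ν y := by simp [hv]
  have hvo : (g.toBilinForm (f y)).IsOrthoᵢ v := by
    intro k l hkl
    simp only [Function.onFun, toBilinForm_apply]
    induction k using Fin.lastCases with
    | last =>
      induction l using Fin.lastCases with
      | last => exact absurd rfl hkl
      | cast j => rw [hvl, hvc, g.symm]; exact hn0 j
    | cast i =>
      induction l using Fin.lastCases with
      | last => rw [hvl, hvc]; exact hn0 i
      | cast j =>
        rw [hvc, hvc]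
        exact hβ fun h ↦ hkl (by rw [h])
  have hvd : ∀ k, g.toBilinForm (f y) (v k) (v k) ≠ 0 := by
    intro k
    induction k using Fin.lastCases with
    | last => rw [toBilinForm_apply, hvl, hνε]; exact hε
    | cast i => rw [toBilinForm_apply, hvc]; exact hd i
  have hli : LinearIndependent ℝ v := LinearMap.linearIndependent_of_isOrthoᵢ hvo hvd
  haveI : FiniteDimensional ℝ (TangentSpace I (f y)) := inferInstanceAs (FiniteDimensional ℝ E)
  have hcard : Fintype.card (Fin (m + 1)) = Module.finrank ℝ (TangentSpace I (f y)) := by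
    show Fintype.card (Fin (m + 1)) = Module.finrank ℝ E
    rw [hm1, Fintype.card_fin]
  set γ := basisOfLinearIndependentOfCardEqFinrank hli hcard with hγdef
  have hγ : ∀ k, γ k = v k := fun k ↦
    congrFun (coe_basisOfLinearIndependentOfCardEqFinrank hli hcard) k
  have hγo : (g.toBilinForm (f y)).IsOrthoᵢ γ := by
    intro k l hkl
    simp only [Function.onFun, hγ]
    exact hvo hkl
  have hγd : ∀ k, g.val (f y) (γ k) (γ k) ≠ 0 := fun k ↦ by rw [hγ]; exact hvd k
  rw [ricci_eq_sum_of_isOrthoᵢ g (f y) γ hγo hγd, Fin.sum_univ_castSucc]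
  simp only [hγ, hvc, hvl, val_riemann_self₁₂, zero_div, add_zero]
  rfl

end Frame

/-! ### The slices of a Riemannian generalized cylinder -/

section Cylinder

variable {E' : Type*} [NormedAddCommGroup E'] [NormedSpace ℝ E'] [FiniteDimensional ℝ E']
  {H' : Type*} [TopologicalSpace H'] {I' : ModelWithCorners ℝ E' H'} [I'.Boundaryless]
  {N : Type*} [TopologicalSpace N] [ChartedSpace H' N] [IsManifold I' ∞ N]
  (G : PseudoRiemannianMetric (I'.prod 𝓘(ℝ, ℝ)) ∞ (E' × ℝ)
    (TangentSpace (I'.prod 𝓘(ℝ, ℝ)) : N × ℝ → Type _))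

omit [FiniteDimensional ℝ E'] [I'.Boundaryless] in
/-- The slices `ι_t : y ↦ (y, t)` of a Riemannian metric on `N × ℝ` are spacelike immersions
(`dι_t v = (v, 0) ≠ 0` for `v ≠ 0`). [folklore] -/
theorem isSpacelikeImmersion_cylSlice (hG : G.IsRiemannian) (t : ℝ) :
    G.IsSpacelikeImmersion I' (fun y : N ↦ ((y, t) : N × ℝ)) := by
  refine ⟨contMDiff_cylSlice (I' := I') t, fun y v hv ↦ ?_⟩
  rw [inducedBilin_apply, mfderiv_cylSlice_apply]
  refine hG (y, t) _ fun h ↦ hv ?_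
  exact congrArg Prod.fst h

omit [FiniteDimensional ℝ E'] in
/-- The variation field `∂_t` along the slice `ι_t` has a `C^∞` lift `N → T(N × ℝ)`
(`contMDiffAt_lift_partialVelocity_slice` for the identity family). [folklore] -/
theorem contMDiff_lift_velocity_cylSlice (t : ℝ) :
    ContMDiff I' (I'.prod 𝓘(ℝ, ℝ)).tangent ∞ (fun y : N ↦
      (TotalSpace.mk' (E' × ℝ) ((y, t) : N × ℝ)
        (velocity (I'.prod 𝓘(ℝ, ℝ)) (fun s : ℝ ↦ ((y, s) : N × ℝ)) t) :
          TangentBundle (I'.prod 𝓘(ℝ, ℝ)) (N × ℝ))) := fun y ↦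
  contMDiffAt_lift_partialVelocity_slice (I := I'.prod 𝓘(ℝ, ℝ)) (f := fun q : N × ℝ ↦ q)
    (eventually_contMDiffAt_id_cyl (I' := I') ((y, t) : N × ℝ))

omit [FiniteDimensional ℝ E'] [I'.Boundaryless] in
/-- On a generalized cylinder `∂_t` is a unit normal of sign `+1` of every slice. [folklore] -/
theorem isUnitNormal_cylSlice
    (hcyl : ∀ (p : N × ℝ) (v w : TangentSpace (I'.prod 𝓘(ℝ, ℝ)) p),
      G.val p v w = G.val p ((v.1, 0) : TangentSpace (I'.prod 𝓘(ℝ, ℝ)) p)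
        ((w.1, 0) : TangentSpace (I'.prod 𝓘(ℝ, ℝ)) p) + v.2 * w.2)
    (t : ℝ) :
    G.IsUnitNormal I' (fun y : N ↦ ((y, t) : N × ℝ))
      (fun y ↦ velocity (I'.prod 𝓘(ℝ, ℝ)) (fun s : ℝ ↦ ((y, s) : N × ℝ)) t) 1 := by
  refine ⟨fun y v ↦ ?_, fun y ↦ ?_⟩
  · show G.val (y, t) (velocity (I'.prod 𝓘(ℝ, ℝ)) (fun s : ℝ ↦ ((y, s) : N × ℝ)) t)
      (mfderiv I' (I'.prod 𝓘(ℝ, ℝ)) (fun y : N ↦ ((y, t) : N × ℝ)) y v) = 0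
    rw [velocity_cylLine, mfderiv_cylSlice_apply]
    exact cyl_val_inr_inl G hcyl (y, t) v
  · show G.val (y, t) (velocity (I'.prod 𝓘(ℝ, ℝ)) (fun s : ℝ ↦ ((y, s) : N × ℝ)) t)
      (velocity (I'.prod 𝓘(ℝ, ℝ)) (fun s : ℝ ↦ ((y, s) : N × ℝ)) t) = 1
    rw [velocity_cylLine]
    exact cyl_val_inr_inr G hcyl (y, t)

omit [I'.Boundaryless] [IsManifold I' ∞ N] in
/-- `dim (N × ℝ) = dim N + 1` on the model spaces. [folklore] -/
theorem finrank_cylModel : Module.finrank ℝ (E' × ℝ) = Module.finrank ℝ E' + 1 := by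
  rw [Module.finrank_prod, Module.finrank_self]

/-! ### The traced Riccati identity -/

variable [G.HasLeviCivita]

set_option maxHeartbeats 800000 in
/-- **The traced Riccati identity on a generalized cylinder** (Bär–Gauduchon–Moroianu 2005,
§4; O'Neill 1983, Ch. 8): for `G = g_t + dt²` Riemannian with the cylinder property, `z ∈ N`,
`t ∈ ℝ`, and a `g_t`-orthogonal basis `β` of `T_zN` (`aᵢ = g_t(βᵢ, βᵢ)`), the function
`τ ↦ ∑ᵢ K_τ(βᵢ, βᵢ)/aᵢ` — whose value at `τ = t` is the mean curvature `H_t(z) = tr_{g_t} K_t` —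
has derivative `-Ric_G(∂_t, ∂_t) + |K_t|²_{g_t}` at `τ = t`: sum the Riccati identity
`hasDerivAt_cyl_secondFundamentalForm_self` over `β` and use
`G(R(∂_t, βᵢ)∂_t, βᵢ) = -G(R(βᵢ, ∂_t)∂_t, βᵢ)`, `Ric(∂_t,∂_t) = ∑ᵢ G(R(βᵢ,∂_t)∂_t, βᵢ)/aᵢ`
(`ricci_normal_eq_sum`), `|D_{βᵢ}∂_t|² = ∑ₗ K(βᵢ,βₗ)²/aₗ` (`val_normalDerivAlong_self_eq_sum`)
and `|K|² = ∑ᵢⱼ Kᵢⱼ²/(aᵢaⱼ)` (`normSq_eq_sum_sq`). [cite: BarHanke2023, §3, (9)] -/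
theorem hasDerivAt_cyl_sum_secondFundamentalForm_div (hG : G.IsRiemannian)
    (hcyl : ∀ (p : N × ℝ) (v w : TangentSpace (I'.prod 𝓘(ℝ, ℝ)) p),
      G.val p v w = G.val p ((v.1, 0) : TangentSpace (I'.prod 𝓘(ℝ, ℝ)) p)
        ((w.1, 0) : TangentSpace (I'.prod 𝓘(ℝ, ℝ)) p) + v.2 * w.2)
    (z : N) (t : ℝ) {m : ℕ} (hm : Module.finrank ℝ E' = m)
    (β : Module.Basis (Fin m) ℝ (TangentSpace I' z))
    (hβ : ((G.inducedMetric (fun y : N ↦ ((y, t) : N × ℝ))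
      (contMDiff_pullbackBilin_holds (I := I'.prod 𝓘(ℝ, ℝ)) (M := N × ℝ) (I' := I') (N := N))
      (isSpacelikeImmersion_cylSlice G hG t)).toBilinForm z).IsOrthoᵢ β) :
    HasDerivAt (fun τ ↦ ∑ i, G.secondFundamentalForm I' (fun y : N ↦ ((y, τ) : N × ℝ))
        (fun y ↦ velocity (I'.prod 𝓘(ℝ, ℝ)) (fun s : ℝ ↦ ((y, s) : N × ℝ)) τ) z (β i) (β i) /
        G.val (z, t) ((β i, 0) : TangentSpace (I'.prod 𝓘(ℝ, ℝ)) (z, t))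
          ((β i, 0) : TangentSpace (I'.prod 𝓘(ℝ, ℝ)) (z, t)))
      (-G.ricci (z, t) (((0 : E'), (1 : ℝ)) : TangentSpace (I'.prod 𝓘(ℝ, ℝ)) (z, t))
          (((0 : E'), (1 : ℝ)) : TangentSpace (I'.prod 𝓘(ℝ, ℝ)) (z, t)) +
        (G.inducedMetric (fun y : N ↦ ((y, t) : N × ℝ))
          (contMDiff_pullbackBilin_holds (I := I'.prod 𝓘(ℝ, ℝ)) (M := N × ℝ) (I' := I') (N := N))
          (isSpacelikeImmersion_cylSlice G hG t)).normSq z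
          (G.secondFundamentalForm I' (fun y : N ↦ ((y, t) : N × ℝ))
            (fun y ↦ velocity (I'.prod 𝓘(ℝ, ℝ)) (fun s : ℝ ↦ ((y, s) : N × ℝ)) t) z)) t := by
  classical
  set I2 := I'.prod 𝓘(ℝ, ℝ) with hI2
  set hpb := contMDiff_pullbackBilin_holds (I := I'.prod 𝓘(ℝ, ℝ)) (M := N × ℝ) (I' := I') (N := N)
    (n := (∞ : ℕ∞ω)) with hpb_def
  have hfi := isSpacelikeImmersion_cylSlice G hG t
  set gN := G.inducedMetric (fun y : N ↦ ((y, t) : N × ℝ)) hpb hfi with hgN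
  set K : ℝ → LinearMap.BilinForm ℝ (TangentSpace I' z) := fun τ ↦
    G.secondFundamentalForm I' (fun y : N ↦ ((y, τ) : N × ℝ))
      (fun y ↦ velocity (I'.prod 𝓘(ℝ, ℝ)) (fun s : ℝ ↦ ((y, s) : N × ℝ)) τ) z with hKdef
  set a : Fin m → ℝ := fun i ↦ G.val (z, t) ((β i, 0) : TangentSpace (I'.prod 𝓘(ℝ, ℝ)) (z, t))
    ((β i, 0) : TangentSpace (I'.prod 𝓘(ℝ, ℝ)) (z, t)) with ha_def
  have hν := contMDiff_lift_velocity_cylSlice (I' := I') (N := N) t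
  have hun := isUnitNormal_cylSlice G hcyl t
  have hm1 : Module.finrank ℝ (E' × ℝ) = m + 1 := by rw [finrank_cylModel, hm]
  have hdim : Module.finrank ℝ (E' × ℝ) = Module.finrank ℝ E' + 1 := finrank_cylModel
  -- the metric coefficients `aᵢ = g_t(βᵢ, βᵢ) = G((βᵢ,0), (βᵢ,0))`
  have ha : ∀ i, gN.val z (β i) (β i) = a i := fun i ↦ by
    show G.val (z, t) (mfderiv I' (I'.prod 𝓘(ℝ, ℝ)) (fun y : N ↦ ((y, t) : N × ℝ)) z (β i))
      (mfderiv I' (I'.prod 𝓘(ℝ, ℝ)) (fun y : N ↦ ((y, t) : N × ℝ)) z (β i)) = a i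
    rw [mfderiv_cylSlice_apply]
  have hd : ∀ i, gN.val z (β i) (β i) ≠ 0 := fun i ↦ by
    rw [ha i]
    refine (hG (z, t) _ fun h ↦ β.ne_zero i ?_).ne'
    exact congrArg Prod.fst h
  -- the Riccati identity on each `βᵢ`, divided by `aᵢ`, summed
  have hK : ∀ i, HasDerivAt (fun τ ↦ K τ (β i) (β i) / a i)
      ((G.val (z, t) (G.leviCivita.curvature (z, t)
          (((0 : E'), (1 : ℝ)) : TangentSpace (I'.prod 𝓘(ℝ, ℝ)) (z, t))
          ((β i, 0) : TangentSpace (I'.prod 𝓘(ℝ, ℝ)) (z, t))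
          (((0 : E'), (1 : ℝ)) : TangentSpace (I'.prod 𝓘(ℝ, ℝ)) (z, t)))
          ((β i, 0) : TangentSpace (I'.prod 𝓘(ℝ, ℝ)) (z, t)) +
        G.val (z, t)
          (G.normalDerivAlong (I' := I') (fun y : N ↦ ((y, t) : N × ℝ))
            (fun y ↦ velocity (I'.prod 𝓘(ℝ, ℝ)) (fun s : ℝ ↦ ((y, s) : N × ℝ)) t) z (β i))
          (G.normalDerivAlong (I' := I') (fun y : N ↦ ((y, t) : N × ℝ))
            (fun y ↦ velocity (I'.prod 𝓘(ℝ, ℝ)) (fun s : ℝ ↦ ((y, s) : N × ℝ)) t) z (β i))) /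
        a i) t := fun i ↦
    (hasDerivAt_cyl_secondFundamentalForm_self G hcyl z t (β i)).div_const (a i)
  have hsum := HasDerivAt.fun_sum (u := Finset.univ) fun i _ ↦ hK i
  refine (hsum.congr_of_eventuallyEq (Eventually.of_forall fun τ ↦ ?_)).congr_deriv ?_
  · simp only [hKdef]
    rfl
  -- the algebra at `t`
  -- (a) curvature terms: antisymmetry and the frame formula for `Ric(∂_t, ∂_t)`
  have hanti : ∀ i, G.val (z, t) (G.leviCivita.curvature (z, t)
      (((0 : E'), (1 : ℝ)) : TangentSpace (I'.prod 𝓘(ℝ, ℝ)) (z, t))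
      ((β i, 0) : TangentSpace (I'.prod 𝓘(ℝ, ℝ)) (z, t))
      (((0 : E'), (1 : ℝ)) : TangentSpace (I'.prod 𝓘(ℝ, ℝ)) (z, t)))
      ((β i, 0) : TangentSpace (I'.prod 𝓘(ℝ, ℝ)) (z, t)) =
      -G.val (z, t) (G.riemann (z, t) ((β i, 0) : TangentSpace (I'.prod 𝓘(ℝ, ℝ)) (z, t))
        (((0 : E'), (1 : ℝ)) : TangentSpace (I'.prod 𝓘(ℝ, ℝ)) (z, t))
        (((0 : E'), (1 : ℝ)) : TangentSpace (I'.prod 𝓘(ℝ, ℝ)) (z, t)))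
        ((β i, 0) : TangentSpace (I'.prod 𝓘(ℝ, ℝ)) (z, t)) := fun i ↦
    val_curvature_antisymm (g := G) (cov := G.leviCivita) (z, t) _ _ _ _
  have hRic := ricci_normal_eq_sum G hpb hfi hun one_ne_zero hm1 z β hβ hd
  rw [← hgN] at hRic
  simp only [velocity_cylLine, mfderiv_cylSlice_apply, ha] at hRic
  -- (b) `|D_{βᵢ}∂_t|²` and `|K|²`
  have hDD : ∀ i, G.val (z, t)
      (G.normalDerivAlong (I' := I') (fun y : N ↦ ((y, t) : N × ℝ))
        (fun y ↦ velocity (I'.prod 𝓘(ℝ, ℝ)) (fun s : ℝ ↦ ((y, s) : N × ℝ)) t) z (β i))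
      (G.normalDerivAlong (I' := I') (fun y : N ↦ ((y, t) : N × ℝ))
        (fun y ↦ velocity (I'.prod 𝓘(ℝ, ℝ)) (fun s : ℝ ↦ ((y, s) : N × ℝ)) t) z (β i)) =
      ∑ l, K t (β i) (β l) ^ 2 / a l := fun i ↦ by
    have h := val_normalDerivAlong_self_eq_sum G hpb hfi hν hun one_ne_zero hdim z β hβ hd (β i)
    rw [← hgN] at h
    simp only [ha] at h
    exact h
  have hnorm : gN.normSq z (K t) = ∑ i, ∑ j, K t (β j) (β i) ^ 2 / (a i * a j) := by
    rw [normSq_eq_sum_sq gN z β hβ hd (K t)]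
    simp only [ha]
  -- assemble
  change ∑ i, _ = -G.ricci (z, t) _ _ + gN.normSq z (K t)
  rw [hRic, hnorm, Finset.sum_comm (f := fun i j ↦ K t (β j) (β i) ^ 2 / (a i * a j)),
    ← Finset.sum_neg_distrib, ← Finset.sum_add_distrib]
  refine Finset.sum_congr rfl fun i _ ↦ ?_
  rw [hanti i, hDD i, add_div, Finset.sum_div, neg_div]
  congr 1
  refine Finset.sum_congr rfl fun l _ ↦ ?_
  rw [div_div]

end Cylinder

end Literature.Geometry.Riemannian
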